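import Literature.AnabelianGeometry.EtaleTheta.TemperedFrobenioidProps
import Literature.AnabelianGeometry.EtaleTheta.TemperedFrobenioidToy
import Literature.AlgebraicGeometry.Frobenioids.PrimesEquivFrobeniusType
import Literature.AlgebraicGeometry.Frobenioids.PadicFrobenioidQpSplit
import HarnessLib

/-!
# [EtTh] Cor. 3.8 (iii): "`Ψ` preserves the non-cuspidal and cuspidal pre-steps" is NOT a property of the
# typed hypotheses — two tempered-Frobenioid structures on ONE category that differ only in the Def. 3.6 (iii)
# (non-)cuspidal data (kernel certificate; closure verdict for FACT-LIST row F-0742)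

S. Mochizuki, *The étale theta function and its Frobenioid-theoretic manifestations*, Publ. RIMS **45**
(2009) [MochizukiEtTh2009], §3: Definition 3.6 (iii) (PDF p. 77: "an element of `Φ(A)` is *non-cuspidal*
(respectively, *cuspidal*) if it arises … from a non-cuspidal (respectively, cuspidal) log-divisor"), (v) (p. 78,
"cuspidally pure") and Corollary 3.8 (iii) (p. 81): "Suppose that `Ψ` preserves the base-field-theoretic
morphisms, and that `Φ₁`, `Φ₂` are cuspidally pure. Then `Ψ` preserves the non-cuspidal and cuspidal pre-steps."
[cite: MochizukiEtTh2009, Cor 3.8 p.81]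

abc-iut cell, block F (FACT-LIST fact-proving wave), seat abc-iut-f-137 (tranche 137); row **F-0742** `Cor38_iii`
of abc-iut-L2-t3's `TemperedFrobenioidProps.lean` (class `preparatory`, kernel_closedness `parametrised`: the
parameter is a record `h : Cor38Hyp C₁ C₂` = an ARBITRARY equivalence of the underlying categories + "`D_i` of
FSMFF-type" + "`Φ_i` non-dilating").  abc-iut-f-015's `TemperedFrobenioidToyTwoPrimes.lean` (p430878) decided the
closures of the sibling rows F-0580 / F-0740 by varying the Def. 3.6 (i) datum `ℝ·Φ₀^cnst` and recorded that
`Cor38_iii` HOLDS (vacuously) at that datum; the closure of F-0742 itself was left open.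

What the kernel certifies here.  The typed predicates "non-cuspidal / cuspidal" (`TemperedFrobenioid.IsNonCuspidal`,
`IsCuspidal`) are read off the Def. 3.6 (iii) data `ncspR` / `cspR` of `RealifiedDivisorMonoids` (and `ncsp₀` / `csp₀`
of Def. 3.3 (iii)), whereas the CATEGORY of a tempered Frobenioid (`TemperedFrobenioid.category`, the model Frobenioid
of `(D, Φ, B, B → Φ^gp)`, [FrdI] Thm. 5.2 (i)) and the predicate "base-field-theoretic" (Def. 3.6 (iv), read off
`ℝ·Φ₀^cnst`) do not involve those data.  Next to abc-iut-L2-t3's degenerate inhabitant `Toy.temperedFrobenioid`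
(`TemperedFrobenioidToy.lean`: one-object base, `Φ = Φ^{ℝ-log} = ℤ_{≥0}` — ONE prime `𝔭` —, `B = ℤ`, `Div(n) = n·𝔭`,
`ℝ·Φ₀^cnst =` everything, EVERY element non-cuspidal) we build the structure `CuspFlip.temperedFrobenioid` with the
SAME Def. 3.3 (iii) / 3.6 (i) / 3.6 (ii) data except that EVERY element is declared CUSPIDAL (`ncsp := 1`,
`csp := Φ`; the unique factorisation "non-cuspidal × cuspidal" of Def. 3.3 (iii) then reads `x = 1 · x`).  Then:

* `CuspFlip.category_eq` — the two structures have literally the same category (`rfl`); the identity is an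
  equivalence and `CuspFlip.hyp : Cor38Hyp Toy.temperedFrobenioid CuspFlip.temperedFrobenioid` (one-object base of
  FSM-, hence FSMFF-type — abc-iut-L1-t4's `PadicFrd.isOfFSMType_discretePUnit`; "non-dilating" reads `True`);
* UNLIKE the TwoPrimes datum, the antecedents of Cor. 3.8 (iii) are MET: `Ψ = id` preserves the base-field-theoretic
  morphisms (`preservesBaseFieldTheoretic_hyp`, the constant locus is shared) and BOTH divisor monoids are cuspidally
  pure (`Toy.isCuspidallyPure`: every primary `𝔭ⁿ` is non-cuspidal and bounded by the base-field-theoretic `𝔭ⁿ`;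
  `CuspFlip.isCuspidallyPure`: Def. 3.6 (v)(a) is VACUOUS when no primary element is non-cuspidal, and the one prime
  is cuspidal);
* the pre-step `ψ = (1, id, 𝔭, 1) : (A, 0) → (A, 𝔭)` is a NON-CUSPIDAL pre-step for `Toy.temperedFrobenioid`
  and a CUSPIDAL, not non-cuspidal, pre-step for `CuspFlip.temperedFrobenioid`;
* hence **`CuspFlip.not_cor38_iii : ¬ Cor38_iii hyp`** and **`CuspFlip.not_forall_cor38_iii`**: the universal closure
  (universe level `0`) of F-0742 AS TYPED is FALSE.

Diagnosis (cell vocabulary, R5).  The two structures are separated exactly by abc-iut-L2-d2's Def. 3.1 support axiom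
`hD1` "base-field-theoretic ⇒ non-cuspidal" (an explicit binder of the instance forms `cor38_iii_of` /
`cor38_iii_of_isOfFSMType` / `Cor38Hyp.cor38_iii_of_preservesPreSteps`, recorded there as an interface finding: not a
field of `RealifiedDivisorMonoids`): it HOLDS for `Toy.temperedFrobenioid` (`Toy.hD1`) and FAILS for
`CuspFlip.temperedFrobenioid` (`CuspFlip.not_hD1`).  So the row is admissible ONLY through those instance forms (and
the identity instance `TemperedFrobenioid.cor38_iii_refl` of `Discharge/Sec3PropsSchemaClosures.lean`), never as its
bare closure.  The gap exhibited is a SCHEMA gap of OUR typed interfaces (print determines the cusps from the curve);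
it is not a claim about the tempered Frobenioids of a curve or about Cor. 3.8 as printed.  HONEST FRAMING: refereed
pre-IUT material; nothing here bears on the disputed [IUTchIII] Cor. 3.12; no side taken.
-/

noncomputable section

namespace Literature.AnabelianGeometry.EtaleTheta

open CategoryTheory Opposite Literature.AlgebraicGeometry.Frobenioids

namespace CuspFlip

/-- `gpMap id = id`, pointwise (the constant functors' transition maps). [folklore] -/
private theorem gpMap_id_apply {M : Type} [CommMonoid M] (x : Algebra.GrothendieckGroup M) :
    gpMap (MonoidHom.id M) x = x :=
  DFunLike.congr_fun (Literature.AlgebraicGeometry.Frobenioids.gpMap_id (M := M)) x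

/-! ### §1 The flipped data: Def. 3.3 (iii) / 3.6 (i) / 3.6 (ii) with EVERY element cuspidal -/

/-- **Def. 3.3 (iii) data, everything cuspidal**: `Φ₀ = ℤ_{≥0}`, `B₀ = ℤ`, `div₀ = (n ↦ n·𝔭)`, `F₀ = B₀` exactly as
in `Toy.divisorMonoids`, but `ncsp₀ := 1`, `csp₀ := Φ₀` (the unique "non-cuspidal × cuspidal" factorisation of
`x` is `1 · x`). [cite: MochizukiEtTh2009, Def 3.3 p.73] -/
def divisorMonoids : DivisorMonoids.{0, 0, 0} (Discrete PUnit.{1}) where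
  Φ₀ := (Functor.const _).obj (CommMonCat.of (Multiplicative ℕ))
  B₀ := (Functor.const _).obj (CommMonCat.of (Multiplicative ℤ))
  isUnit_B₀ _ b := by
    change IsUnit (M := Multiplicative ℤ) b
    exact Group.isUnit _
  div₀ _ := Toy.divHom
  div₀_natural _ b := (gpMap_id_apply (Toy.divHom b)).symm
  F₀ _ := ⊤
  F₀_map _ _ _ := trivial
  ncsp₀ _ := ⊥
  csp₀ _ := ⊤
  ncsp₀_map _ x hx := by
    rw [Submonoid.mem_bot] at hx ⊢
    rw [hx, map_one]
  csp₀_map _ _ _ := trivial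
  existsUnique_ncsp_csp _ x := by
    refine ⟨(⟨1, Submonoid.mem_bot.mpr rfl⟩, ⟨x, trivial⟩), one_mul x, ?_⟩
    rintro ⟨a, c⟩ h
    have ha : a.1 = 1 := Submonoid.mem_bot.mp a.2
    have hc : c.1 = x := by
      have h' : a.1 * c.1 = x := h
      rwa [ha, one_mul] at h'
    exact Prod.ext (Subtype.ext ha) (Subtype.ext hc)

/-- **Def. 3.6 (i) data, everything cuspidal** (`Λ = ℤ`, `Φ₀^ℝ = Φ₀`, `B₀^Λ = B₀ = ℤ`, `F₀^Λ = B₀^Λ`,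
`ℝ·Φ₀^cnst =` all of `(Φ₀^ℝ)^gp` — as in `Toy.realified`), with `ncspR := 1`, `cspR := Φ₀^ℝ`.
[cite: MochizukiEtTh2009, Def 3.6 p.76] -/
def realified : RealifiedDivisorMonoids (D₀ := Discrete PUnit.{1}) Toy.monoidVocab where
  toDivisorMonoids := divisorMonoids
  Λ := MonoidType.Z
  ΦR := (Functor.const _).obj (CommMonCat.of (Multiplicative ℕ))
  toR _ := MonoidHom.id _
  toR_natural _ _ := rfl
  isRealification _ := trivial
  BΛ := (Functor.const _).obj (CommMonCat.of (Multiplicative ℤ))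
  isUnit_BΛ _ b := by
    change IsUnit (M := Multiplicative ℤ) b
    exact Group.isUnit _
  divΛ _ := Toy.divHom
  divΛ_natural _ b := (gpMap_id_apply (Toy.divHom b)).symm
  FΛ _ := ⊤
  FΛ_map _ _ _ := trivial
  cnstR _ := ⊤
  cnstR_map _ _ _ := trivial
  divΛ_mem_cnstR _ _ _ := trivial
  cnstR_root _ _ _ _ := trivial
  cnst_le_cnstR _ _ _ := trivial
  ncspR _ := ⊥
  cspR _ := ⊤
  toR_ncsp _ _ hx := hx
  toR_csp _ _ _ := trivial

/-- **Def. 3.6 (ii), everything cuspidal**: the tempered-Frobenioid interface over the flipped data, with the SAME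
fields as `Toy.temperedFrobenioid` (`D = D₀` one object, `Φ = Φ^{ℝ-log} = ℤ_{≥0}` group-saturated, `Φ^{bs-fld} = Φ`
monoprime, the constant `1 ∈ ℤ = F` has divisor `𝔭 ≠ 0`) — none of them mentions the Def. 3.6 (iii) data.
[cite: MochizukiEtTh2009, Def 3.6 p.77] -/
def temperedFrobenioid : TemperedFrobenioid realified (Discrete PUnit.{1}) Toy.catVocab where
  isConnected := zigzag_isConnected fun j₁ j₂ => by rw [Subsingleton.elim j₁ j₂]
  isTotallyEpimorphic := ⟨fun f => ⟨fun _ _ _ => Subsingleton.elim _ _⟩⟩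
  base := 𝟭 _
  Φ := ⟨fun _ => ⊤, fun _ _ _ => trivial⟩
  isGroupSaturated A := (isGroupSaturated_iff' _).2 fun _ _ _ _ _ _ => trivial
  isPerfFactorial _ := trivial
  isDivisorialOn := trivial
  isMonoprime_bsFld A := Toy.isMonoprime_of_eq_top
    (eq_top_iff.2 fun x _ => Submonoid.mem_inf.2 ⟨Submonoid.mem_top x,
      (Subgroup.mem_top (Algebra.GrothendieckGroup.of x) :
        Algebra.GrothendieckGroup.of x ∈ (⊤ : Subgroup (Algebra.GrothendieckGroup (Multiplicative ℕ))))⟩)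
  exists_FΛ_div_ne A := ⟨(Multiplicative.ofAdd (1 : ℤ) : Multiplicative ℤ), trivial,
    (Multiplicative.ofAdd (1 : ℕ) : Multiplicative ℕ), trivial, (1 : Multiplicative ℕ), trivial,
    fun h => Nat.one_ne_zero (Multiplicative.ofAdd.injective h),
    Toy.divHom_ofAdd_one.trans (by
      change Algebra.GrothendieckGroup.of (M := Multiplicative ℕ) (Multiplicative.ofAdd 1) =
        Algebra.GrothendieckGroup.of (M := Multiplicative ℕ) (Multiplicative.ofAdd 1) /
          Algebra.GrothendieckGroup.of (M := Multiplicative ℕ) 1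
      rw [(Algebra.GrothendieckGroup.of (M := Multiplicative ℕ)).map_one, div_one])⟩

/-! ### §2 One category, two structures; the hypotheses of Cor. 3.8 (iii) are met -/

/-- **The two structures have literally the same underlying category** (the model Frobenioid of
`(D, Φ, B, B → Φ^gp)` does not involve the Def. 3.6 (iii) data). [cite: MochizukiEtTh2009, Def 3.6 p.77] -/
theorem category_eq : Toy.temperedFrobenioid.category = temperedFrobenioid.category := rfl

/-- The identity functor as an equivalence `C₁ ≌ C₂` between the two structures' categories.
[cite: MochizukiEtTh2009, Cor 3.8 p.80] -/
def idEquiv : Toy.temperedFrobenioid.category ≌ temperedFrobenioid.category := CategoryTheory.Equivalence.refl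

/-- **The standing hypotheses of Cor. 3.8 hold** for `C₁ := Toy.temperedFrobenioid` (everything non-cuspidal),
`C₂ := CuspFlip.temperedFrobenioid` (everything cuspidal), `Ψ := id`: both bases are the one-object category (of
FSM-, hence FSMFF-type) and "non-dilating" reads `True` in the trivial vocabulary. [cite: MochizukiEtTh2009, Cor 3.8 p.80] -/
def hyp : Cor38Hyp Toy.temperedFrobenioid temperedFrobenioid where
  Ψ := idEquiv
  fsmff := ⟨PadicFrd.isOfFSMType_discretePUnit.isOfFSMFFType, PadicFrd.isOfFSMType_discretePUnit.isOfFSMFFType⟩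
  nonDilating := ⟨fun _ _ => trivial, fun _ _ => trivial⟩

/-- **First antecedent of Cor. 3.8 (iii) MET: `Ψ = id` preserves the base-field-theoretic morphisms** (the two
structures share `Φ` and `ℝ·Φ₀^cnst`, off which "base-field-theoretic" is read; here every morphism is
base-field-theoretic on both sides). [cite: MochizukiEtTh2009, Cor 3.8 p.81] -/
theorem preservesBaseFieldTheoretic_hyp : PreservesBaseFieldTheoretic hyp :=
  fun _ => ⟨fun _ => ⟨trivial, trivial⟩, fun _ => ⟨trivial, trivial⟩⟩

/-- The Def. 3.1 support axiom `hD1` "base-field-theoretic ⇒ non-cuspidal" of abc-iut-L2-d2's `cor38_iii_of` HOLDS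
for `Toy.temperedFrobenioid` (everything is non-cuspidal). [cite: MochizukiEtTh2009, Def 3.6 p.78] -/
theorem _root_.Literature.AnabelianGeometry.EtaleTheta.Toy.hD1 :
    ∀ (A : (Discrete PUnit.{1})ᵒᵖ) (y : Toy.temperedFrobenioid.Φ.carrier A),
      Toy.temperedFrobenioid.IsBaseFieldTheoreticDiv y → Toy.temperedFrobenioid.IsNonCuspidal y :=
  fun _ _ _ => trivial

/-- **Second antecedent MET on the `C₁` side: `Toy.temperedFrobenioid` is cuspidally pure** — (a) a primary
(non-cuspidal) `x` is bounded by the base-field-theoretic `x` itself; (b) every prime is non-cuspidal and, being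
inhabited by primary (`≠ 0`) elements, not cuspidal. [cite: MochizukiEtTh2009, Def 3.6 p.78] -/
theorem _root_.Literature.AnabelianGeometry.EtaleTheta.Toy.isCuspidallyPure :
    Toy.temperedFrobenioid.IsCuspidallyPure where
  exists_bsFld_dvd _ x _ _ := ⟨x, ⟨trivial, trivial⟩, dvd_rfl⟩
  ncsp_or_csp _ _ := Or.inl fun _ _ => trivial
  not_ncsp_and_csp _ 𝔮 := fun h => by
    obtain ⟨a, hpa, _⟩ := Primes.exists_mem_carrier 𝔮
    exact hpa.1 (Subtype.ext (Submonoid.mem_bot.mp (h.2 a ⟨hpa, ‹_›⟩)))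

/-- The support axiom `hD1` "base-field-theoretic ⇒ non-cuspidal" FAILS for `CuspFlip.temperedFrobenioid`: the
base-field-theoretic divisor `𝔭` is not non-cuspidal.  This is exactly the datum the typed interface
`RealifiedDivisorMonoids` leaves free and abc-iut-L2-d2's instance forms bind by name.
[cite: MochizukiEtTh2009, Def 3.6 p.78] -/
theorem not_hD1 :
    ¬ ∀ (A : (Discrete PUnit.{1})ᵒᵖ) (y : temperedFrobenioid.Φ.carrier A),
      temperedFrobenioid.IsBaseFieldTheoreticDiv y → temperedFrobenioid.IsNonCuspidal y := fun h =>
  Nat.one_ne_zero (Multiplicative.ofAdd.injective (α := ℕ) (Submonoid.mem_bot.mp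
    (h (op ⟨⟨⟩⟩) ⟨(Multiplicative.ofAdd (1 : ℕ) : Multiplicative ℕ), trivial⟩ ⟨trivial, trivial⟩)))

/-- **Second antecedent MET on the `C₂` side: `CuspFlip.temperedFrobenioid` is cuspidally pure** — Def. 3.6 (v)(a)
is VACUOUS (no primary element is non-cuspidal: non-cuspidal means `= 0`), and (b) every prime is cuspidal and
not non-cuspidal. [cite: MochizukiEtTh2009, Def 3.6 p.78] -/
theorem isCuspidallyPure : temperedFrobenioid.IsCuspidallyPure where
  exists_bsFld_dvd _ x hx hn := absurd (Subtype.ext (Submonoid.mem_bot.mp hn)) hx.1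
  ncsp_or_csp _ _ := Or.inr fun _ _ => trivial
  not_ncsp_and_csp _ 𝔮 := fun h => by
    obtain ⟨a, hpa, _⟩ := Primes.exists_mem_carrier 𝔮
    exact hpa.1 (Subtype.ext (Submonoid.mem_bot.mp (h.1 a ⟨hpa, ‹_›⟩)))

/-! ### §3 The separating pre-step -/

/-- The prime `𝔭 = 1 ∈ ℤ_{≥0} = Φ(A)`, as an element of the divisor monoid of the common category (the ascription
keeps the numeral in `ℕ`: against the abstract carrier a bare `Multiplicative.ofAdd 1` would elaborate to the unit).
[cite: MochizukiEtTh2009, Def 3.6 p.77] -/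
def 𝔭 : Toy.temperedFrobenioid.divisorMonoid.obj (op ⟨⟨⟩⟩) :=
  ⟨(Multiplicative.ofAdd (1 : ℕ) : Multiplicative ℕ), trivial⟩

/-- `𝔭 ≠ 0` in `Φ^{ℝ-log}(A) = ℤ_{≥0}`. [cite: MochizukiEtTh2009, Def 3.6 p.77] -/
theorem val_𝔭_ne_one : (Subtype.val 𝔭 : Toy.temperedFrobenioid.ΦRlog.obj (op ⟨⟨⟩⟩)) ≠ 1 := fun h =>
  Nat.one_ne_zero (Multiplicative.ofAdd.injective (α := ℕ) h)

/-- The object `(A, 0)` of the common category. [cite: MochizukiEtTh2009, Def 3.6 p.77] -/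
def X : Toy.temperedFrobenioid.category := ⟨⟨⟨⟩⟩, 1⟩

/-- The object `(A, 𝔭)` of the common category. [cite: MochizukiEtTh2009, Def 3.6 p.77] -/
def Y : Toy.temperedFrobenioid.category := ⟨⟨⟨⟩⟩, Algebra.GrothendieckGroup.of 𝔭⟩

/-- The pre-step `ψ = (1, id, 𝔭, 1) : (A, 0) → (A, 𝔭)` of the common category ([FrdI] Thm. 5.2 (i):
`0 + 𝔭 = id^* 𝔭 + Div(1)`) — Frobenius degree `1`, base identity, zero divisor `𝔭`. [cite: MochizukiEtTh2009, Def 3.6 p.77] -/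
def ψ : X ⟶ Y where
  degFr := 1
  base := 𝟙 _
  div := 𝔭
  unit := 1
  rel := by
    show (1 : Algebra.GrothendieckGroup (Toy.temperedFrobenioid.divisorMonoid.obj (op ⟨⟨⟩⟩))) ^ ((1 : ℕ+) : ℕ) *
        Algebra.GrothendieckGroup.of 𝔭 =
      pullGp Toy.temperedFrobenioid.divisorMonoid (𝟙 (⟨⟨⟩⟩ : Discrete PUnit.{1}))
          (Algebra.GrothendieckGroup.of 𝔭) *
        divB Toy.temperedFrobenioid.divisorMonoid Toy.temperedFrobenioid.ratFnFunctor
          Toy.temperedFrobenioid.divBNatTrans (op ⟨⟨⟩⟩) 1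
    rw [pullGp_id, map_one, mul_one, PNat.one_coe, pow_one, one_mul]

/-- `ψ` is a pre-step (linear, base-isomorphism) for the structure `Toy.temperedFrobenioid`.
[cite: MochizukiEtTh2009, Def 3.6 p.77] -/
theorem isPreStep_ψ : PreFrobenioid.IsPreStep Toy.temperedFrobenioid.toElem ψ :=
  ⟨rfl, show IsIso (𝟙 X.base) from inferInstance⟩

/-- `Ψ(ψ) = ψ` is a pre-step for the structure `CuspFlip.temperedFrobenioid` (same pre-Frobenioid structure).
[cite: MochizukiEtTh2009, Def 3.6 p.77] -/
theorem isPreStep_map_ψ : PreFrobenioid.IsPreStep temperedFrobenioid.toElem (hyp.Ψ.functor.map ψ) :=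
  ⟨rfl, show IsIso (𝟙 X.base) from inferInstance⟩

/-- `ψ` IS a non-cuspidal pre-step for `Toy.temperedFrobenioid` (`𝔭` non-cuspidal there).
[cite: MochizukiEtTh2009, Def 3.6 p.77] -/
theorem isNonCuspidalPreStep_ψ : Toy.temperedFrobenioid.IsNonCuspidalPreStep ψ := ⟨isPreStep_ψ, trivial⟩

/-- `ψ` is NOT a cuspidal pre-step for `Toy.temperedFrobenioid` (`𝔭 ≠ 0` is not cuspidal there).
[cite: MochizukiEtTh2009, Def 3.6 p.77] -/
theorem not_isCuspidalPreStep_ψ : ¬ Toy.temperedFrobenioid.IsCuspidalPreStep ψ :=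
  fun h => val_𝔭_ne_one (Submonoid.mem_bot.mp h.2)

/-- `Ψ(ψ) = ψ` IS a cuspidal pre-step for `CuspFlip.temperedFrobenioid` (`𝔭` cuspidal there).
[cite: MochizukiEtTh2009, Def 3.6 p.77] -/
theorem isCuspidalPreStep_map_ψ : temperedFrobenioid.IsCuspidalPreStep (hyp.Ψ.functor.map ψ) :=
  ⟨isPreStep_map_ψ, trivial⟩

/-- `Ψ(ψ) = ψ` is NOT a non-cuspidal pre-step for `CuspFlip.temperedFrobenioid` (`𝔭 ≠ 0` is not non-cuspidal there).
[cite: MochizukiEtTh2009, Def 3.6 p.77] -/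
theorem not_isNonCuspidalPreStep_map_ψ : ¬ temperedFrobenioid.IsNonCuspidalPreStep (hyp.Ψ.functor.map ψ) :=
  fun h => val_𝔭_ne_one (Submonoid.mem_bot.mp h.2)

/-! ### §4 Row F-0742 at `hyp` -/

/-- **`Ψ = id : C₁ ⥲ C₂` does NOT preserve the non-cuspidal pre-steps although every typed hypothesis of Cor. 3.8
(iii) holds at `hyp`**: F-0742 fails at `hyp`. [cite: MochizukiEtTh2009, Cor 3.8 p.81] -/
theorem not_cor38_iii : ¬ Cor38_iii hyp := fun h =>
  not_isNonCuspidalPreStep_map_ψ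
    ((h preservesBaseFieldTheoretic_hyp Toy.isCuspidallyPure isCuspidallyPure ψ).1.1 isNonCuspidalPreStep_ψ)

/-- The cuspidal clause of F-0742 fails at `hyp` as well (independently of the non-cuspidal one).
[cite: MochizukiEtTh2009, Cor 3.8 p.81] -/
theorem not_cor38_iii_cuspidal_clause :
    ¬ ∀ {A B : Toy.temperedFrobenioid.category} (f : A ⟶ B),
      Toy.temperedFrobenioid.IsCuspidalPreStep f ↔ temperedFrobenioid.IsCuspidalPreStep (hyp.Ψ.functor.map f) :=
  fun h => not_isCuspidalPreStep_ψ ((h ψ).2 isCuspidalPreStep_map_ψ)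

/-- **F-0742 as typed is not a fact over ALL `Cor38Hyp` records:** the universal closure (universe level `0`) of
abc-iut-L2-t3's `Cor38_iii` is FALSE.  Instance forms of record (all conditional on, i.a., the support axiom `hD1`
that separates the two structures here): abc-iut-L2-d2's `cor38_iii_of` / `cor38_iii_of_isOfFSMType` /
`cor38_iii_ofRlfZ`, abc-iut-w5-d124's `Cor38Hyp.cor38_iii_of_preservesPreSteps` /
`Cor38Hyp.cor38_iii_treeCatVocab_of_preservesPreSteps`, and the identity instance `TemperedFrobenioid.cor38_iii_refl`.
[cite: MochizukiEtTh2009, Cor 3.8 p.81] -/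
theorem not_forall_cor38_iii :
    ¬ ∀ {D₀ : Type} [Category.{0} D₀] {V : FrdIMonoidStub.{0}} {T : RealifiedDivisorMonoids (D₀ := D₀) V}
        {D : Type} [Category.{0} D] {VD : FrdICatStub.{0, 0, 0} D}
        {D₀' : Type} [Category.{0} D₀'] {T' : RealifiedDivisorMonoids (D₀ := D₀') V}
        {D' : Type} [Category.{0} D'] {VD' : FrdICatStub.{0, 0, 0} D'}
        {C₁ : TemperedFrobenioid T D VD} {C₂ : TemperedFrobenioid T' D' VD'} (h : Cor38Hyp C₁ C₂),
        Cor38_iii h :=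
  fun h => not_cor38_iii (h hyp)

end CuspFlip

end Literature.AnabelianGeometry.EtaleTheta

end
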